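import Summits.BirchSwinnertonDyer.BirchSwinnertonDyer.Theorems.GenusKolyvaginAtTwoMinimalTwinBSDTwoComponentRoadFrame
import Summits.BirchSwinnertonDyer.BirchSwinnertonDyer.Theorems.GenusKolyvaginAtTwoMinimalTwinBSDTwoJetchevSplit
import Literature.NumberTheory.EllipticCurves.CanonicalPAdicHeightRestrictionProofs
import HarnessLib

/-!
# Route `GenusKolyvaginAtTwo`, crux U₂ `MinimalTwinBSDTwo` (stmt-BirchSwinnertonDyer-22985), LINE 23 «twin_swap», stub DIV′:
# THE COMPONENT CELL — U₂ on the Δ<0 slice from the wall, the converse, NDIV⁻ and GZ III (3.1): crux 27467 REPLACED BY PRINT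
# on the cell where one bad prime sees the `2`-part of the Tamagawa product through a generator

Seat `bsd-line-gk2-p2` g29 (PROVER 2/3, cell `bsd-f1-sign2`; LINE 23 holder), `--supports stmt-BirchSwinnertonDyer-22985` (helper; closes nothing).
THEOREMS ONLY (no definition, no named fact, no `sorry`); standard axioms.  **BSD is NOT proved by this file; U₂ / DIV′ / NDIV⁻ are NOT proved; no
item is closed.**  §1 is UNCONDITIONAL infrastructure; §2 is CONDITIONAL (D-0014) on the four PRINT facts of the route (GZ, GZK, modularity, Milne),
on LINE 23's anchor S1 (rank-`0` wall on `2`-Selmer-trivial non-CM curves), on the rank-zero `2`-converse CONV₀ (items 19218/19219 + residual, as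
one hypothesis `hC0`), on the statement-only PUBLISHED fact `Gross1991_heegnerPoint_sub_ratTorsion_mem_E0_imageFree` (GZ III (3.1)), and on the
research statement NDIV⁻ of gk2-p2 g28 (text VERBATIM from `JetchevSplit.bsdp_negDisc_of_wall_of_converse_of_tamagawaDivisibility_of_ndiv_of_facts`).

WHAT.  gk2-p2 g28 proved U₂ on the slice 𝒮 ∩ {Δ<0} (`N_W` odd, `ρ_{W,2^∞}` onto, odd-Manin optimal datum, the `2`-part of `C(W)` at one prime
`q₀`) from S1 + CONV₀ + **27467 `TamagawaDivisibilityAtTwo`** (Jetchev at `2`, beyond print: the DIV half) + NDIV⁻ + PRINT.  Here 27467 is replaced by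
GZ III (3.1) (PRINT) on the COMPONENT CELL: the curve carries a point `g ∈ E(ℚ)` generating `E(ℚ)/tors` whose component class at some bad prime `q₁`
has `2`-order `≥ 2^{ord₂ C(W)}` («`k • g ∈ E₀(ℚ) at q₁ ⟹ 2^{ord₂ C(W)} ∣ k`», read on the tree's `nonsingularReductionSubgroupAt q₁`).

* §1 `mem_nonsingularReductionSubgroupAt_of_hasNonsingularReduction_placeIntModel` — DESCENT of `E₀` for RATIONAL points: if the image of `P ∈ E(ℚ)`
  in `E(L)` has nonsingular reduction at a place `w ∣ ℓ` of a number field `L`, then `P ∈ E₀(ℚ)` at `ℓ` (valuations of rationals at `w`;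
  companion of the ascent inside the tree's `isAdmissibleK_pointToBaseChange`); `exists_heightOneSpectrum_natCast_mem'` (a place above `ℓ`).
* §2 ★ `bsdp_negDisc_of_wall_of_converse_of_GZ31_of_component_of_ndiv_of_facts` — **U₂ on 𝒮 ∩ {Δ<0} ∩ (component cell) ⟸ S1 + CONV₀ + GZ III (3.1) +
  NDIV⁻ + PRINT**: g28's cell theorem with `hJ : TamagawaDivisibilityAtTwo` REPLACED by `hGZ31` and the per-curve component hypothesis
  (DIV from `ComponentRoad.exists_two_pow_smul_eq_derivedPoint_one_of_generator_componentOrder_of_analyticRank_eq_one`, p795624).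

READING (census): on the component cell the only beyond-print inputs of U₂ are S1 (wall), CONV₀ (sibling route) and NDIV⁻ (Kolyvagin non-vanishing at 2);
the Jetchev-type half is PRINT there.  Off the component cell (generator in `E₀(ℚ_{q₀})` up to odd multiples, or two primes carrying `2`-parts) DIV′
stays with 27467 / beyond print.  BSD is NOT proved; nothing is closed.

References: [GrossLMS1991] §6 proof of Prop. 6.2 (1); [GrossZagier1986Heegner] III (3.1), V §2 (2.2); [Milne1972ArithmeticAV] §1 Thm. 1; [Kramer1981]
Thm. 1; [SilvermanAEC2009] VII §2 Prop. 2.1, VIII §2; [Jetchev2008] Thm. 1.4 (comparison only).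
-/

set_option autoImplicit false
set_option linter.dupNamespace false -- `Summit.<P>.<Sub>` repeats `BirchSwinnertonDyer` (D-0017)

noncomputable section

open scoped Classical

open NumberField WeierstrassCurve IsDedekindDomain
open Literature.NumberTheory.EllipticCurves Literature.NumberTheory.EllipticCurves.ModularForms
  Literature.NumberTheory.EllipticCurves.Rank1Residual Literature.NumberTheory.QuadraticFields
  Summit.BirchSwinnertonDyer.Rank1Residual Summit.BirchSwinnertonDyer.Rank1Residual.AdditivePotMult
  Summit.BirchSwinnertonDyer.BirchSwinnertonDyer.Rank1Residual
  Summit.BirchSwinnertonDyer.BirchSwinnertonDyer.Theorems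
  Summit.BirchSwinnertonDyer.BirchSwinnertonDyer.Theorems.GenusExact.TwinSwap
open Summit.BirchSwinnertonDyer.BirchSwinnertonDyer.Theses.GenusKolyvaginAtTwo
open Summit.BirchSwinnertonDyer.BirchSwinnertonDyer.Theses.ByReductionTypeAtTwo
  (GoodOrdinaryRankZeroAtTwo MultiplicativeRankZeroAtTwo SupersingularRankZeroAtTwo AdditiveRankZeroAtTwo)
open Summit.BirchSwinnertonDyer.BirchSwinnertonDyer.Theses.TwoAdicConverse (GoodOrdinaryRankZeroTwoConverse MultiplicativeRankZeroTwoConverse)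
open Summit.BirchSwinnertonDyer.BirchSwinnertonDyer.Theorems.GenusExact.TwinSwap.Ledger.Line25
  (entireLFunction_twist_one_ne_zero_of_rankZeroTwoConverse_of_natCard_selmerGroup_eq_one
    not_isOfFinAddOrder_derivedPoint_one_of_rankOne_of_lValue_ne_zero rankZeroTwoConverse_of_items_of_offSemistable)
open Summit.BirchSwinnertonDyer.BirchSwinnertonDyer.Theorems.GenusExact.TwinSwap.OneBit (swappedPairDescentAtTwo_tamagawaDepth_of_facts)
open Summit.BirchSwinnertonDyer.BirchSwinnertonDyer.Theorems.GenusExact.TwinSwap.DoorOpen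
  (exists_doorOpen_prime_heegnerField_selmerTrivialTwin hasSurjectiveModNGaloisRep_two_of_negDisc_of_natCard_selmerGroup_eq_two)
open Summit.BirchSwinnertonDyer.BirchSwinnertonDyer.Theorems.GenusExact.TwinSwap.ComponentRoad
  (exists_two_pow_smul_eq_derivedPoint_one_of_generator_componentOrder_of_analyticRank_eq_one)

namespace Summit.BirchSwinnertonDyer.BirchSwinnertonDyer.Theorems.GenusExact.TwinSwap.ComponentCell

/-! ## §1 Descent of `E₀` for rational points; a place above a prime -/

section Descent

variable {L : Type} [Field L] [NumberField L] {w : HeightOneSpectrum (𝓞 L)}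

/-- A rational with `ord_ℓ q ≥ 0` has `|q|_w ≤ 1` at every place `w` above `ℓ`. [folklore] -/
theorem valuation_ratCast_le_one_of_padicValRat_nonneg {ℓ : ℕ} (hℓ : ℓ.Prime) (hℓw : (ℓ : 𝓞 L) ∈ w.asIdeal) {q : ℚ}
    (hq : 0 ≤ padicValRat ℓ q) : w.valuation L (q : L) ≤ 1 := by
  haveI : Fact ℓ.Prime := ⟨hℓ⟩
  by_cases hq0 : q = 0
  · rw [hq0, Rat.cast_zero, map_zero]; exact zero_le_one
  -- `ℓ ∤ den q`: otherwise `ℓ ∤ num q` and `ord_ℓ q = − ord_ℓ (den q) < 0`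
  have hden : ¬ ℓ ∣ q.den := by
    intro hd
    have hnum : ¬ (ℓ : ℤ) ∣ q.num := not_dvd_num_of_dvd_den hℓ hd
    have h1 : padicValRat ℓ q = -(padicValNat ℓ q.den : ℤ) := by
      rw [padicValRat, padicValInt.eq_zero_of_not_dvd hnum]; simp
    have h2 : 0 < padicValNat ℓ q.den := by
      have := one_le_padicValNat_of_dvd (p := ℓ) q.den_nz hd
      omega
    omega
  have hden' : ¬ (ℓ : ℤ) ∣ (q.den : ℤ) := fun h ↦ hden (Int.natCast_dvd_natCast.mp h)
  rw [Rat.cast_def, map_div₀, ← Int.cast_natCast, valuation_intCast_eq_one_of_not_dvd hℓ hℓw hden', div_one]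
  have e : ((q.num : ℤ) : L) = algebraMap (𝓞 L) L (q.num : 𝓞 L) := by simp
  rw [e]
  exact HeightOneSpectrum.valuation_le_one w _

/-- A rational with `ord_ℓ q > 0` has `|q|_w < 1` at every place `w` above `ℓ`. [folklore] -/
theorem valuation_ratCast_lt_one_of_padicValRat_pos {ℓ : ℕ} (hℓ : ℓ.Prime) (hℓw : (ℓ : 𝓞 L) ∈ w.asIdeal) {q : ℚ}
    (hq : 0 < padicValRat ℓ q) : w.valuation L (q : L) < 1 := by
  haveI : Fact ℓ.Prime := ⟨hℓ⟩
  have hq0 : q ≠ 0 := by rintro rfl; simp at hq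
  -- `ℓ ∣ num q` (else `ord_ℓ q ≤ 0`), hence `ℓ ∤ den q`
  have hnum : (ℓ : ℤ) ∣ q.num := by
    by_contra hn
    have h1 : padicValRat ℓ q = -(padicValNat ℓ q.den : ℤ) := by
      rw [padicValRat, padicValInt.eq_zero_of_not_dvd hn]; simp
    have : (0 : ℤ) ≤ padicValNat ℓ q.den := Int.natCast_nonneg _
    omega
  have hden : ¬ ℓ ∣ q.den := fun hd ↦ not_dvd_num_of_dvd_den hℓ hd hnum
  have hden' : ¬ (ℓ : ℤ) ∣ (q.den : ℤ) := fun h ↦ hden (Int.natCast_dvd_natCast.mp h)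
  rw [Rat.cast_def, map_div₀, ← Int.cast_natCast, valuation_intCast_eq_one_of_not_dvd hℓ hℓw hden', div_one]
  have e : ((q.num : ℤ) : L) = algebraMap (𝓞 L) L (q.num : 𝓞 L) := by simp
  rw [e, HeightOneSpectrum.valuation_lt_one_iff_mem]
  obtain ⟨m, hm⟩ := hnum
  have : (q.num : 𝓞 L) = (ℓ : 𝓞 L) * (m : 𝓞 L) := by rw [hm]; push_cast; ring
  rw [this]
  exact w.asIdeal.mul_mem_right _ hℓw

/-- **DESCENT OF `E₀` FOR RATIONAL POINTS.**  `W/ℚ` integral, `L` a number field, `w` a place of `L` above the prime `ℓ`, `P ∈ E(ℚ)`: if the image of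
`P` in `E(L)` has nonsingular reduction at `w` (on the model `W`, `placeIntModel`), then `P ∈ E₀(ℚ)` at `ℓ` (the tree's `nonsingularReductionSubgroupAt`).
(The ascent is inside `isAdmissibleK_pointToBaseChange`; both are valuations of rationals at `w`.) [cite: SilvermanAEC2009, VII §2 Prop. 2.1] -/
theorem mem_nonsingularReductionSubgroupAt_of_hasNonsingularReduction_placeIntModel (W : WeierstrassCurve ℚ) [W.IsIntegral ℤ]
    (w : HeightOneSpectrum (𝓞 L)) {ℓ : ℕ} [Fact ℓ.Prime] (hℓw : (ℓ : 𝓞 L) ∈ w.asIdeal) (P : W.toAffine.Point)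
    (h : WeierstrassCurve.HasNonsingularReduction (K := L) (placeIntModel W L w) (W.pointToBaseChange L P)) :
    P ∈ W.nonsingularReductionSubgroupAt ℓ := by
  have hℓ : ℓ.Prime := Fact.out
  rcases P with _ | ⟨x, y, hxy⟩
  · exact AddSubgroup.zero_mem _
  · rw [mem_nonsingularReductionSubgroupAt_iff]
    change W.HasNonsingularReductionAt ℓ x y
    have hK : W.HasNonsingularReductionAtK L w (algebraMap ℚ L x) (algebraMap ℚ L y) :=
      (hasNonsingularReduction_placeIntModel_iff (W := W) (K := L) w _).mp h
    unfold WeierstrassCurve.HasNonsingularReductionAtK at hK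
    rw [baseChange_polynomialX_evalEval, baseChange_polynomialY_evalEval, eq_ratCast, eq_ratCast, eq_ratCast] at hK
    unfold WeierstrassCurve.HasNonsingularReductionAt
    by_contra hQ
    simp only [not_or, not_and, not_lt] at hQ
    obtain ⟨hx, hΦx, hΦy⟩ := hQ
    -- each `v`-adic alternative contradicts the corresponding `ℓ`-adic negation
    have key : ∀ r : ℚ, (r ≠ 0 → padicValRat ℓ r ≠ 0) → w.valuation L (r : L) ≠ 1 := by
      intro r hr hv
      by_cases hr0 : r = 0
      · rw [hr0, Rat.cast_zero, map_zero] at hv; exact zero_ne_one hv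
      rcases lt_or_gt_of_ne (hr hr0) with hneg | hpos
      · exact (one_lt_valuation_ratCast_of_padicValRat_neg hℓ hℓw hneg).ne' hv
      · exact (valuation_ratCast_lt_one_of_padicValRat_pos hℓ hℓw hpos).ne hv
    rcases hK with h1 | h2 | h3
    · exact (not_lt.mpr (valuation_ratCast_le_one_of_padicValRat_nonneg hℓ hℓw hx)) h1
    · exact key _ hΦx h2
    · exact key _ hΦy h3

/-- A rational prime lies under some finite place of every number field. [folklore] -/
theorem exists_heightOneSpectrum_natCast_mem' {ℓ : ℕ} (hℓ : ℓ.Prime) :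
    ∃ w : HeightOneSpectrum (𝓞 L), (ℓ : 𝓞 L) ∈ w.asIdeal := by
  have hnu : ¬ IsUnit (ℓ : 𝓞 L) := by
    intro hu
    have h := hu.map (Algebra.norm ℤ)
    rw [show (ℓ : 𝓞 L) = algebraMap ℤ (𝓞 L) (ℓ : ℤ) by simp, Algebra.norm_algebraMap,
      isUnit_pow_iff, Int.isUnit_iff_natAbs_eq, Int.natAbs_natCast] at h
    · exact hℓ.one_lt.ne' h
    · rw [RingOfIntegers.rank]; exact Module.finrank_pos.ne'
  obtain ⟨M, hM, hM'⟩ := Ideal.exists_le_maximal (Ideal.span {(ℓ : 𝓞 L)}) (fun h ↦ hnu (Ideal.span_singleton_eq_top.1 h))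
  have hMbot : M ≠ ⊥ := by
    intro h
    rw [h, le_bot_iff, Ideal.span_singleton_eq_bot] at hM'
    exact hℓ.ne_zero (by exact_mod_cast hM')
  exact ⟨⟨M, hM.isPrime, hMbot⟩, hM' (Ideal.mem_span_singleton_self _)⟩

/-- `E(ℚ) → E(L)` commutes with integer multiples, for an ARBITRARY `DecidableEq` instance on `L` (the tree's `pointToBaseChange_add` is stated
with the classical one; the group laws agree since `DecidableEq L` is a subsingleton). [folklore] -/
theorem pointToBaseChange_zsmul' (W : WeierstrassCurve ℚ) (L : Type) [Field L] [NumberField L] [DecidableEq L] (k : ℤ)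
    (P : W.toAffine.Point) : W.pointToBaseChange L (k • P) = k • W.pointToBaseChange L P := by
  obtain rfl : ‹DecidableEq L› = fun a b ↦ Classical.propDecidable (a = b) := Subsingleton.elim _ _
  let φ : W.toAffine.Point →+ (W.baseChange L).toAffine.Point := AddMonoidHom.mk' (W.pointToBaseChange L) (pointToBaseChange_add W L)
  show φ (k • P) = k • φ P
  rw [map_zsmul]

end Descent

/-! ## §2 The component cell: g28's Δ<0 slice theorem with 27467 replaced by GZ III (3.1) -/

/-- ★ **U₂ ON THE COMPONENT CELL OF THE Δ<0 SLICE ⟸ S1 + CONV₀ + GZ III (3.1) + NDIV⁻ + PRINT.**  Hypotheses: PRINT (`hGZ hGZK hmod hMilneC`); `hS1` =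
LINE 23's anchor (rank-`0` wall on non-CM `2`-Selmer-trivial curves); `hC0` = the rank-zero `2`-converse; `hGZ31` = Gross 1991 §6 / GZ III (3.1)
(statement-only, PUBLISHED); `hNDIV` = NDIV⁻ VERBATIM from gk2-p2 g28's `JetchevSplit.bsdp_negDisc_of_wall_of_converse_of_tamagawaDivisibility_of_ndiv_of_facts`.
CONCLUSION: `BSDp W 2` for every non-CM globally minimal `W` with `r_an = 1`, `#Sel₂(W) = 2`, `Δ_W < 0`, `N_W` odd, `ρ_{W,2^∞}` onto, an odd-Manin
optimal datum, the `2`-part of `C(W)` at one prime `q₀` — AND the COMPONENT CLAUSE: some `g ∈ E(ℚ)` generating `E(ℚ)/tors` and some prime `q₁ ∣ N_W`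
with «`k • g ∈ E₀(ℚ)` at `q₁` ⟹ `2^{ord₂ C(W)} ∣ k`».  Proof = g28's, with DIV supplied by the component road (p795624) instead of crux 27467.
CONDITIONAL on the displayed hypotheses; BSD is NOT proved; nothing is closed.
[cite: GrossLMS1991, §6, proof of Prop. 6.2 (1), p. 245] [cite: GrossZagier1986Heegner, III (3.1)] [cite: GrossZagier1986, V.§2 (2.2)]
[cite: Milne1972ArithmeticAV, §1 Thm. 1] [cite: Kramer1981, Thm. 1] -/
theorem bsdp_negDisc_of_wall_of_converse_of_GZ31_of_component_of_ndiv_of_facts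
    (hGZ : ∀ (N : ℕ) [NeZero N] (W : WeierstrassCurve ℚ) (K : Type) [Field K] [NumberField K], gross_zagier N W K)
    (hGZK : rank_eq_analyticRank_of_analyticRank_le_one) (hmod : hasEntireLFunction_rat)
    (hMilneC : Milne1972.bsdQuotient_baseChange_quadratic_anyModel)
    (hS1 : ∀ (W : WeierstrassCurve ℚ) [W.IsElliptic] [W.IsGloballyMinimal],
      ¬ W.HasCM → W.analyticRank = 0 → Nat.card (W.selmerGroup 2) = 1 → BSDp W 2)
    (hC0 : ∀ (V : WeierstrassCurve ℚ) [V.IsElliptic] [V.IsGloballyMinimal], ¬ V.HasCM → V.selmerCorank 2 = 0 → V.analyticRank = 0)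
    (hGZ31 : Gross1991_heegnerPoint_sub_ratTorsion_mem_E0_imageFree)
    (hNDIV : ∀ (W : WeierstrassCurve ℚ) [W.IsElliptic] [W.IsGloballyMinimal] [NeZero (W.conductorNorm ℤ)],
      ¬ W.HasCM → W.analyticRank = 1 → Nat.card (W.selmerGroup 2) = 2 → W.Δ < 0 → ¬ 2 ∣ W.conductorNorm ℤ →
      (∀ n : ℕ, 0 < n → W.HasSurjectiveModNGaloisRep ((2 : ℤ) ^ n)) →
      (∃ (q₀ : ℕ) (_ : Fact q₀.Prime), (q₀ : ℤ) ∣ W.conductorNorm ℤ ∧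
        padicValNat 2 ((W.baseChange ℚ_[q₀]).localTamagawaNumber ℤ_[q₀]) = padicValNat 2 W.tamagawaProduct) →
      ∀ (K : Type) [Field K] [NumberField K], IsImaginaryQuadratic K →
        ∀ (ℓ : ℕ) [Fact ℓ.Prime], NumberField.discr K = -(ℓ : ℤ) → ¬ W.selmerGroup 2 ≤ MazurRubin2010.strictLocalKer W ℚ_[ℓ] 2 →
        Odd (NumberField.discr K) → NumberField.discr K ≠ -3 → SatisfiesHeegnerHypothesis (W.conductorNorm ℤ) K →
        ((Ideal.span {(2 : ℤ)}).primesOver (𝓞 K)).ncard = 2 →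
        (W.quadraticTwist (NumberField.discr K : ℚ)).entireLFunction 1 ≠ 0 →
        ∀ (Dt : ModularParametrizationData W (W.conductorNorm ℤ)),
          (∀ z ∈ Dt.L.lattice, ∃ w ∈ periodLattice Dt.f, z = (Dt.c : ℂ) * w) → Odd Dt.c →
        ∀ (β : ℤ) (ι : K →+* ℂ) (d₁ : KolyvaginHeegnerData Dt β ι 1),
          ¬ ∃ Q : (W.baseChange (ringClassField K ι 1)).toAffine.Point,
            ((2 ^ (padicValNat 2 W.tamagawaProduct + 1) : ℕ) : ℤ) • Q = d₁.derivedPoint) :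
    ∀ (W : WeierstrassCurve ℚ) [W.IsElliptic] [W.IsGloballyMinimal] [NeZero (W.conductorNorm ℤ)], ¬ W.HasCM → W.analyticRank = 1 →
      Nat.card (W.selmerGroup 2) = 2 → W.Δ < 0 → ¬ 2 ∣ W.conductorNorm ℤ →
      (∀ n : ℕ, 0 < n → W.HasSurjectiveModNGaloisRep ((2 : ℤ) ^ n)) →
      (∃ Dt : ModularParametrizationData W (W.conductorNorm ℤ),
        (∀ z ∈ Dt.L.lattice, ∃ w ∈ periodLattice Dt.f, z = (Dt.c : ℂ) * w) ∧ Odd Dt.c) →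
      (∃ (q₀ : ℕ) (_ : Fact q₀.Prime), (q₀ : ℤ) ∣ W.conductorNorm ℤ ∧
        padicValNat 2 ((W.baseChange ℚ_[q₀]).localTamagawaNumber ℤ_[q₀]) = padicValNat 2 W.tamagawaProduct) →
      (∃ (g : W.toAffine.Point) (q₁ : ℕ) (_ : Fact q₁.Prime), (q₁ : ℤ) ∣ W.conductorNorm ℤ ∧
        (∀ x : W.toAffine.Point, ∃ k : ℤ, IsOfFinAddOrder (x - k • g)) ∧
        ∀ k : ℤ, k • g ∈ W.nonsingularReductionSubgroupAt q₁ → ((2 ^ padicValNat 2 W.tamagawaProduct : ℕ) : ℤ) ∣ k) →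
      BSDp W 2 := by
  intro W _ _ _ hcm hr hSel hΔ hN hρ hopt hq₀ hGEN
  -- rank one (GZK), so `ρ̄_{W,2}` is onto on `Δ < 0`, and `E(ℚ)[2] = 0`
  have hrk : W.mordellWeilRank = 1 := by rw [(hGZK W (le_of_eq hr)).1, hr]
  have hsurj : W.HasSurjectiveModNGaloisRep 2 :=
    hasSurjectiveModNGaloisRep_two_of_negDisc_of_natCard_selmerGroup_eq_two W hΔ hSel hrk
  obtain ⟨-, hT2, -⟩ := rank_eq_one_and_sha_primary_eq_zero_of_natCard_selmerGroup_eq_two W hSel hrk.ge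
  have hT2' : ∀ P : W.toAffine.Point, 2 • P = 0 → P = 0 := fun P hP ↦ by convert hT2 P (by convert hP)
  -- the door-open prime Heegner field with its globally minimal Sel₂-trivial twin costing exactly one bit (unconditional)
  obtain ⟨ℓ, hℓF, -, -, -, hns, K, _, _, hK, hd, hodd, h3, hH, h2K, -, -, Wd, _, _, ⟨Cd, hCd⟩, hSel1, hTam⟩ :=
    exists_doorOpen_prime_heegnerField_selmerTrivialTwin W hΔ hsurj hSel 0
  haveI := hℓF
  have hD0 : (NumberField.discr K : ℚ) ≠ 0 := by exact_mod_cast NumberField.discr_ne_zero K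
  haveI := W.isElliptic_quadraticTwist hD0
  -- the central value through the rank-zero 2-converse
  have hL : (W.quadraticTwist (NumberField.discr K : ℚ)).entireLFunction 1 ≠ 0 :=
    entireLFunction_twist_one_ne_zero_of_rankZeroTwoConverse_of_natCard_selmerGroup_eq_one hC0 hmod W hcm hD0 Wd hCd hSel1
  -- the conductor-1 datum ON THE ODD-MANIN OPTIMAL DATUM, its Heegner point of infinite order
  obtain ⟨Dt, hlat, hc⟩ := hopt
  obtain ⟨β, hβ⟩ : ∃ β : ℤ, (4 * (W.conductorNorm ℤ : ℕ) : ℤ) ∣ β ^ 2 - NumberField.discr K :=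
    Quadratic.exists_dvd_sq_sub_discr_of_ncard_primesOver hK.1 (NeZero.ne _) hH
  obtain ⟨ι⟩ : Nonempty (K →+* ℂ) := inferInstance
  obtain ⟨d₁⟩ := exists_kolyvaginHeegnerData_one (phi_heegnerTau_mem_singularModuliField_holds (W.conductorNorm ℤ) W K) hK Dt β ι hβ
  have hc0 : Dt.c ≠ 0 := fun h ↦ Dt.cast_c_ne_zero (by rw [h, Int.cast_zero])
  have hy : ¬ IsOfFinAddOrder d₁.derivedPoint :=
    not_isOfFinAddOrder_derivedPoint_one_of_rankOne_of_lValue_ne_zero hmod W K (hGZ _ W K) hK hH hr hL d₁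
  have hc2 : padicValInt 2 Dt.c = 0 :=
    padicValInt.eq_zero_of_not_dvd fun h ↦ (Int.not_even_iff_odd.mpr hc) (even_iff_two_dvd.mpr (by exact_mod_cast h))
  -- NDIV from `hNDIV`
  have hndiv : ¬ ∃ Q : (W.baseChange (ringClassField K ι 1)).toAffine.Point,
      ((2 ^ (padicValInt 2 Dt.c + padicValNat 2 W.tamagawaProduct + 1) : ℕ) : ℤ) • Q = d₁.derivedPoint := by
    rw [hc2, zero_add]
    exact hNDIV W hcm hr hSel hΔ hN hρ hq₀ K hK ℓ hd hns hodd h3 hH h2K hL Dt hlat hc β ι d₁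
  -- DIV from the COMPONENT ROAD (GZ III (3.1)) instead of crux 27467
  haveI : NumberField (ringClassField K ι 1) := numberField_ringClassField hK ι one_ne_zero
  obtain ⟨g, q₁, hq₁F, hq₁N, hgen, hcomp⟩ := hGEN
  obtain ⟨w₀, hw₀⟩ := exists_heightOneSpectrum_natCast_mem' (L := ringClassField K ι 1) hq₁F.out
  have hw₀N : (((W.conductorNorm ℤ : ℕ) : ℕ) : 𝓞 (ringClassField K ι 1)) ∈ w₀.asIdeal := by
    obtain ⟨m, hm⟩ := hq₁N
    have hmN : ((W.conductorNorm ℤ : ℕ) : ℤ) = q₁ * m := hm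
    obtain ⟨m', hm'⟩ : ∃ m' : ℕ, (W.conductorNorm ℤ : ℕ) = q₁ * m' := by
      refine ⟨m.toNat, ?_⟩
      have hm0 : 0 ≤ m := by
        by_contra hneg
        have : (q₁ : ℤ) * m ≤ 0 := mul_nonpos_of_nonneg_of_nonpos (Int.natCast_nonneg _) (by omega)
        have hpos : (0 : ℤ) < ((W.conductorNorm ℤ : ℕ) : ℤ) := by exact_mod_cast (NeZero.pos (W.conductorNorm ℤ))
        omega
      have : ((W.conductorNorm ℤ : ℕ) : ℤ) = ((q₁ * m.toNat : ℕ) : ℤ) := by push_cast; rw [Int.toNat_of_nonneg hm0]; exact hmN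
      exact_mod_cast this
    rw [hm', Nat.cast_mul]
    exact w₀.asIdeal.mul_mem_right _ hw₀
  -- `E(ℚ) → E(K)` as a group homomorphism on `W.toAffine.Point` (the tree's `pointToBaseChange_add`)
  let φK : W.toAffine.Point →+ (W.baseChange K).toAffine.Point :=
    AddMonoidHom.mk' (W.pointToBaseChange K) (pointToBaseChange_add W K)
  have hincl : ∀ P : W.toAffine.Point, QuadraticDescent.incl K W P = W.pointToBaseChange K P := fun P ↦ by
    rw [pointToBaseChange_eq_map]; rfl
  have hgK : ∀ x : W.toAffine.Point, ∃ k : ℤ,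
      IsOfFinAddOrder (QuadraticDescent.incl K W x - k • QuadraticDescent.incl K W g) := by
    intro x
    obtain ⟨k, hk⟩ := hgen x
    refine ⟨k, ?_⟩
    have h := (W.isOfFinAddOrder_pointToBaseChange_iff K (x - k • g)).mpr hk
    have hφ : W.pointToBaseChange K (x - k • g) = W.pointToBaseChange K x - k • W.pointToBaseChange K g := by
      show φK (x - k • g) = φK x - k • φK g
      rw [map_sub, map_zsmul]
    rwa [hφ, ← hincl x, ← hincl g] at h
  have hs : ∀ k : ℤ, WeierstrassCurve.HasNonsingularReduction (K := ringClassField K ι 1)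
      (placeIntModel W (ringClassField K ι 1) w₀) (k • W.pointToBaseChange (ringClassField K ι 1) g) →
      ((2 ^ padicValNat 2 W.tamagawaProduct : ℕ) : ℤ) ∣ k := by
    intro k hk
    refine hcomp k (mem_nonsingularReductionSubgroupAt_of_hasNonsingularReduction_placeIntModel W w₀ hw₀ (k • g) ?_)
    have e : W.pointToBaseChange (ringClassField K ι 1) (k • g) = k • W.pointToBaseChange (ringClassField K ι 1) g :=
      pointToBaseChange_zsmul' W (ringClassField K ι 1) k g
    rw [e]
    exact hk
  have hdiv : ∃ Q : (W.baseChange (ringClassField K ι 1)).toAffine.Point,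
      ((2 ^ (padicValInt 2 Dt.c + padicValNat 2 W.tamagawaProduct) : ℕ) : ℤ) • Q = d₁.derivedPoint := by
    rw [hc2, zero_add]
    exact exists_two_pow_smul_eq_derivedPoint_one_of_generator_componentOrder_of_analyticRank_eq_one hGZ31 W hT2' hr hK hodd h3 hH
      Dt β ι d₁ g hgK w₀ hw₀N (padicValNat 2 W.tamagawaProduct) hs
  -- the twin is non-CM of analytic rank 0: `BSD₂(Wd)` from the wall; descend
  have hcmd : ¬ Wd.HasCM := by
    rw [← hCd, hasCM_iff_of_j_eq (((W.quadraticTwist (NumberField.discr K : ℚ)).variableChange_j Cd).trans (W.j_quadraticTwist hD0))]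
    exact hcm
  have hrd : Wd.analyticRank = 0 := by
    rw [← hCd, analyticRank_smul]
    exact ((W.quadraticTwist (NumberField.discr K : ℚ)).analyticRank_eq_zero_iff_holds (hmod _)).mpr hL
  have hBd : BSDp Wd 2 := hS1 Wd hcmd hrd hSel1
  exact swappedPairDescentAtTwo_tamagawaDepth_of_facts hGZ hGZK hmod hMilneC W hr hSel hΔ K hK hodd h3 hH Dt hc0 β ι d₁ hy hdiv hndiv
    Wd ⟨Cd, hCd⟩ hSel1 hTam.le hBd

/-! ## §3 The item ledger of the component cell (BY NAME) -/

/-- ★ **THE ITEM LEDGER OF THE COMPONENT CELL (BY NAME).**  With the route's items as hypotheses — WALL row 1 `GoodOrdinaryRankZeroAtTwo` (stmt-19095),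
`MultiplicativeRankZeroAtTwo`, `SupersingularRankZeroAtTwo`, `AdditiveRankZeroAtTwo`; the rank-zero `2`-converse items `GoodOrdinaryRankZeroTwoConverse`
(stmt-19218), `MultiplicativeRankZeroTwoConverse` (stmt-19219) and the declared off-semistable residual (`r = 0` text); the four print items
`GrossZagierAllLevels` (24148), `MultPublishedInputsAtTwo` (19921), `EntireLFunctionRat` (19273), `MilneAnyModel` (24149); the statement-only PRINT fact
`Gross1991_heegnerPoint_sub_ratTorsion_mem_E0_imageFree` (GZ III (3.1)) — plus the ONE research statement NDIV⁻ (text of §2): **U₂ holds on the component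
cell of the slice** {`Δ_W < 0`, `N_W` odd, `ρ_{W,2^∞}` onto, an odd-Manin optimal datum, the `2`-part of `C(W)` at one prime, a generator whose component
class at one bad prime has `2`-order `≥ 2^{ord₂ C(W)}`}.  Compared with gk2-p2 g28's `JetchevSplit.bsdp_negDisc_slice_of_items_of_ndiv`: crux 27467 is
NOT an input here.  CONDITIONAL; proves nothing about BSD; closes nothing.
[cite: GrossLMS1991, §6, proof of Prop. 6.2 (1), p. 245] [cite: GrossZagier1986, V.§2 (2.2)] [cite: Milne1972ArithmeticAV, §1 Thm. 1] -/
theorem bsdp_negDisc_componentCell_of_items_of_GZ31_of_ndiv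
    (hOrd : GoodOrdinaryRankZeroAtTwo) (hMult : MultiplicativeRankZeroAtTwo) (hSS : SupersingularRankZeroAtTwo) (hAdd : AdditiveRankZeroAtTwo)
    (hC0g : GoodOrdinaryRankZeroTwoConverse) (hC0m : MultiplicativeRankZeroTwoConverse)
    (hC0r : ∀ (V : WeierstrassCurve ℚ) [V.IsElliptic] [V.IsGloballyMinimal], ¬ V.HasCM → ¬ (GoodOrd V 2 ∨ Mult V 2) →
      V.selmerCorank 2 = 0 → V.analyticRank = 0)
    (hGZ31 : Gross1991_heegnerPoint_sub_ratTorsion_mem_E0_imageFree)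
    (hGZ : GrossZagierAllLevels) (hGZK : MultPublishedInputsAtTwo) (hL : EntireLFunctionRat) (hMi : MilneAnyModel)
    (hNDIV : ∀ (W : WeierstrassCurve ℚ) [W.IsElliptic] [W.IsGloballyMinimal] [NeZero (W.conductorNorm ℤ)],
      ¬ W.HasCM → W.analyticRank = 1 → Nat.card (W.selmerGroup 2) = 2 → W.Δ < 0 → ¬ 2 ∣ W.conductorNorm ℤ →
      (∀ n : ℕ, 0 < n → W.HasSurjectiveModNGaloisRep ((2 : ℤ) ^ n)) →
      (∃ (q₀ : ℕ) (_ : Fact q₀.Prime), (q₀ : ℤ) ∣ W.conductorNorm ℤ ∧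
        padicValNat 2 ((W.baseChange ℚ_[q₀]).localTamagawaNumber ℤ_[q₀]) = padicValNat 2 W.tamagawaProduct) →
      ∀ (K : Type) [Field K] [NumberField K], IsImaginaryQuadratic K →
        ∀ (ℓ : ℕ) [Fact ℓ.Prime], NumberField.discr K = -(ℓ : ℤ) → ¬ W.selmerGroup 2 ≤ MazurRubin2010.strictLocalKer W ℚ_[ℓ] 2 →
        Odd (NumberField.discr K) → NumberField.discr K ≠ -3 → SatisfiesHeegnerHypothesis (W.conductorNorm ℤ) K →
        ((Ideal.span {(2 : ℤ)}).primesOver (𝓞 K)).ncard = 2 →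
        (W.quadraticTwist (NumberField.discr K : ℚ)).entireLFunction 1 ≠ 0 →
        ∀ (Dt : ModularParametrizationData W (W.conductorNorm ℤ)),
          (∀ z ∈ Dt.L.lattice, ∃ w ∈ periodLattice Dt.f, z = (Dt.c : ℂ) * w) → Odd Dt.c →
        ∀ (β : ℤ) (ι : K →+* ℂ) (d₁ : KolyvaginHeegnerData Dt β ι 1),
          ¬ ∃ Q : (W.baseChange (ringClassField K ι 1)).toAffine.Point,
            ((2 ^ (padicValNat 2 W.tamagawaProduct + 1) : ℕ) : ℤ) • Q = d₁.derivedPoint) :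
    ∀ (W : WeierstrassCurve ℚ) [W.IsElliptic] [W.IsGloballyMinimal] [NeZero (W.conductorNorm ℤ)], ¬ W.HasCM → W.analyticRank = 1 →
      Nat.card (W.selmerGroup 2) = 2 → W.Δ < 0 → ¬ 2 ∣ W.conductorNorm ℤ →
      (∀ n : ℕ, 0 < n → W.HasSurjectiveModNGaloisRep ((2 : ℤ) ^ n)) →
      (∃ Dt : ModularParametrizationData W (W.conductorNorm ℤ),
        (∀ z ∈ Dt.L.lattice, ∃ w ∈ periodLattice Dt.f, z = (Dt.c : ℂ) * w) ∧ Odd Dt.c) →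
      (∃ (q₀ : ℕ) (_ : Fact q₀.Prime), (q₀ : ℤ) ∣ W.conductorNorm ℤ ∧
        padicValNat 2 ((W.baseChange ℚ_[q₀]).localTamagawaNumber ℤ_[q₀]) = padicValNat 2 W.tamagawaProduct) →
      (∃ (g : W.toAffine.Point) (q₁ : ℕ) (_ : Fact q₁.Prime), (q₁ : ℤ) ∣ W.conductorNorm ℤ ∧
        (∀ x : W.toAffine.Point, ∃ k : ℤ, IsOfFinAddOrder (x - k • g)) ∧
        ∀ k : ℤ, k • g ∈ W.nonsingularReductionSubgroupAt q₁ → ((2 ^ padicValNat 2 W.tamagawaProduct : ℕ) : ℤ) ∣ k) →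
      BSDp W 2 :=
  bsdp_negDisc_of_wall_of_converse_of_GZ31_of_component_of_ndiv_of_facts hGZ hGZK hL hMi
    (fun W _ _ hCM hr _ ↦ by
      -- S1 from WALL row 1 by the reduction-type tetrachotomy at `2`
      by_cases hg : W.HasGoodReductionAtPrime 2
      · by_cases hd : ((2 : ℕ) : ℤ) ∣ W.frobeniusTrace 2
        · exact hSS W hCM hr ⟨hg, hd⟩
        · exact hOrd W hCM hr ⟨hg, hd⟩
      · by_cases hm : W.HasMultiplicativeReductionAtPrime 2
        · exact hMult W hCM hr hm
        · exact hAdd W hCM hr ⟨hg, hm⟩)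
    (rankZeroTwoConverse_of_items_of_offSemistable hC0g hC0m hC0r) hGZ31 hNDIV

end Summit.BirchSwinnertonDyer.BirchSwinnertonDyer.Theorems.GenusExact.TwinSwap.ComponentCell

end
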